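import Literature.Probability.Percolation.TrapFencedExit
import HarnessLib

/-!
# The landing move of an exit along an arbitrary chain of tubes

Topic: Probability / Percolation; family `crit-perc` (site percolation on the triangular lattice
`𝕋 = triGraph`). The first brick of the GENERIC landing layer of Nolin's arm-separation theorem
(Nolin 2008, Thm. 11, §4.3 Prop. 12 and §4.4 [arXiv 0711.4948: Prop. 11, Thm. 10, p. 12]: "we
can extend the arms using RSW in corridors (Fig. 6)"), towards
`Literature.Probability.Percolation.Nolin2008_prop17_quasiMult` (`FiveArmExponentFacts.lean`).

The tree's move `rot_exit_landing_move_row'` (`TrapFencedExit.lean`) takes the corridor of an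
exit to be a spoke, ONE arc of a thin ring `arc (thinRing r e s) a len`, an approach tube and the
thinned target free space. For `k` exits in a general position the arcs of the `k` corridors
cannot always be placed at single levels (the nesting constraints can be cyclic); corridors must
be STAIRCASES — chains of ring pieces at increasing levels joined by radial connectors. The
gluing `out_landing_glue` (`ArmSeparationOutMove.lean`) is already stated for an arbitrary chain
`E :: L` of pairwise-crossing consecutive tubes; this file records the move for an arbitrary
crossed chain `Lc` (`List.IsChain Crosses Lc`, `ω ∈ eventAll Lc`) whose boxes lie in the annulus
`{n ≤ |v| ≤ 4M}`, which contains the entry tube met by the spoke and the chunks of the exit run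
on the ring of radius `r` from which the approach tube departs.

## Main results

* `rot_exit_landing_move_chain'` — exit read through `ρ^i` + spoke + crossed chain + approach +
  target ⇒ `ω ∈ extOpenArm n (4M)`; `rot_exit_landing_move_chain` — the same for a fenced exit.

## References

* P. Nolin, *Near-critical percolation in two dimensions*, Electron. J. Probab. 13 (2008), §4.3
  Prop. 12, Lemma 13, §4.4 (arXiv 0711.4948: Prop. 11, Lemma 12; proof of Thm. 10, p. 12,
  Fig. 6). [Nolin2008]
* H. Kesten, *Scaling relations for 2D-percolation*, Comm. Math. Phys. 109 (1987), Lemma 4.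
  [Kesten1987]
-/

noncomputable section

open Set

namespace Literature.Probability.Percolation

open LatticeModels Tube

/-- **The landing move of an exit read through `ρ^i`, along an arbitrary crossed chain of tubes,
to the right side of `∂Λ_{4M}`**: `ω ∈ extOpenArm n (4M)`. The chain `Lc` is crossed
(`eventAll`), consecutive tubes cross (`List.IsChain Crosses`), its boxes lie in `{n ≤ |v| ≤ 4M}`,
it contains the entry tube `Te` met by the spoke of the exit and the chunks
`vchunks r (-r) e s j₀ (d + 1)` of the exit run at the radius `r` of the approach. [cite: Nolin2008, §4.3 Prop. 12 and §4.4 (arXiv 0711.4948: Prop. 11, Thm. 10, p. 12, Fig. 6)] -/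
theorem rot_exit_landing_move_chain' {M n k₀ K R₀ : ℕ} (hnM : n ≤ M) {i : ℕ} (hi : i < 6) {ω : SiteConfig (Site 2)}
    (F : TrapExit M n k₀ K (rotConfig i ω)) (hmid : -(2 * (M : ℤ)) + R₀ ≤ F.z 1 ∧ F.z 1 ≤ -(R₀ : ℤ))
    (hR : 4 * F.k + 2 ≤ R₀) (hkM : 2 * (F.k : ℤ) + 1 ≤ M)
    {T₀ : ℤ} {w : ℕ} (hwin : T₀ ≤ F.z 1 ∧ F.z 1 < T₀ + w) (hT₀ : -(2 * (M : ℤ)) ≤ T₀)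
    {L ε : ℕ} (hfit : (w : ℤ) + (F.k / 4 : ℕ) + 2 * ε ≤ F.k) (hL : F.k + 1 ≤ L) (hSp : ω ∈ extSpokeEvent i M F.k T₀ w L ε)
    {Lc : List Tube} (hch : List.IsChain Crosses Lc) (harc : ω ∈ eventAll Lc)
    (hLreg : ∀ T ∈ Lc, T.box ⊆ triAnnulusSet n (4 * M))
    {Te : Tube} (hTe : Te ∈ Lc) (hJ : SpokeMeetsRot i (extSpokeTube M F.k T₀ w L ε) Te)
    {t : ℤ} (ht : -(2 * (M : ℤ)) + (4 * M / 16 : ℕ) ≤ t ∧ t ≤ -(M : ℤ) - (4 * M / 16 : ℕ))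
    {r e s j₀ d : ℕ} (he : 2 * e ≤ r) (hSL : ∀ T ∈ vchunks r (-(r : ℤ)) e s j₀ (d + 1), T ∈ Lc)
    (hlo : -(r : ℤ) + j₀ * s - e ≤ t) (hhi : t + (4 * M / 64 : ℕ) ≤ -(r : ℤ) + (j₀ + d) * s - e)
    {W : ℕ} (hW : (r : ℤ) - 2 * e + W = 4 * M + (4 * M / 16 : ℕ))
    (hH : ω ∈ triHCross ((r : ℤ) - 2 * e) t W (4 * M / 64)) (hV : ω ∈ otgtV (4 * M) t)
    (hM : 64 ≤ M) (hkL : (F.k : ℤ) + L ≤ 2 * M) (hnr : (n : ℤ) ≤ (r : ℤ) - 2 * e) (hrN : (r : ℤ) + e ≤ 4 * M) :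
    ω ∈ extOpenArm n (4 * M) := by
  have hR' : 4 * (F.k : ℤ) + 2 ≤ R₀ := by exact_mod_cast hR
  have hnM' : (n : ℤ) ≤ M := by exact_mod_cast hnM
  obtain ⟨hz0, hz1, hz2⟩ := trapO_coord F.z_mem
  obtain ⟨hm1, hm2⟩ := hmid
  have ht4 : F.z 1 + 4 * F.k + 2 ≤ 0 := by omega
  obtain ⟨hland, htr1, htr2⟩ := tgtRow_facts ht
  -- the chain as a nonempty chain with prescribed crossings
  obtain ⟨E, L', hEL⟩ := List.exists_cons_of_ne_nil (List.ne_nil_of_mem hTe)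
  have harc' : ∀ T ∈ E :: L', ω ∈ T.event := fun T hT => harc T (hEL ▸ hT)
  have hch' : List.IsChain Crosses (E :: L') := hEL ▸ hch
  obtain ⟨X, Y, hXY⟩ := exists_crossings harc'
  have hTe' : Te ∈ E :: L' := hEL ▸ hTe
  have hLreg' : ∀ T ∈ E :: L', T.box ⊆ triAnnulusSet n (4 * M) := fun T hT => hLreg T (hEL ▸ hT)
  -- the hook
  have P₁ := trapExit_to_entry hi F hwin hfit hL hSp (hXY Te hTe') hJ
  -- everything lies in the annulus
  have hreg : (triRotIsoPow i '' ((extSpokeTube M F.k T₀ w L ε).box ∪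
      (triAnnSet n (2 * M) ∪ trapExitZone M F.z F.k ∪ triStrip (F.z 0 + F.k) (F.z 1 + F.k) F.k F.k)) ∪ Te.box) ⊆
      triAnnulusSet n (4 * M) ∪ triOpenBall ![((4 * M : ℕ) : ℤ), t] (4 * M / 8) :=
    (hook_region F.z_mem hkM ht4 hwin hT₀ hfit hkL hnM (hLreg' Te hTe')).trans subset_union_left
  -- glue
  have hna : triNorm (triRotIsoPow i F.a) = n := by rw [triNorm_rot, F.norm_a]
  exact out_landing_glue (n := n) (N' := 4 * M) (t := t) ⟨htr1, htr2⟩ hland hch' hXY hLreg'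
    hreg hTe' hna P₁ (fun T hT => hEL ▸ hSL T hT) hlo hhi hnr he (by push_cast; exact hW) hH hV (by omega)
    (by push_cast; omega)

/-- **The landing move along a crossed chain, for a fenced exit** (through `toTrapExit`). [cite: Nolin2008, §4.3 Prop. 12 and §4.4 (arXiv 0711.4948: Prop. 11, Thm. 10, p. 12)] -/
theorem rot_exit_landing_move_chain {M n k₀ K R₀ : ℕ} (hnM : n ≤ M) {i : ℕ} (hi : i < 6) {ω : SiteConfig (Site 2)}
    (F : TrapFencedExit M n k₀ K (rotConfig i ω)) (hmid : -(2 * (M : ℤ)) + R₀ ≤ F.z 1 ∧ F.z 1 ≤ -(R₀ : ℤ))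
    (hR : 4 * F.k + 2 ≤ R₀) (hkM : 2 * (F.k : ℤ) + 1 ≤ M)
    {T₀ : ℤ} {w : ℕ} (hwin : T₀ ≤ F.z 1 ∧ F.z 1 < T₀ + w) (hT₀ : -(2 * (M : ℤ)) ≤ T₀)
    {L ε : ℕ} (hfit : (w : ℤ) + (F.k / 4 : ℕ) + 2 * ε ≤ F.k) (hL : F.k + 1 ≤ L) (hSp : ω ∈ extSpokeEvent i M F.k T₀ w L ε)
    {Lc : List Tube} (hch : List.IsChain Crosses Lc) (harc : ω ∈ eventAll Lc)
    (hLreg : ∀ T ∈ Lc, T.box ⊆ triAnnulusSet n (4 * M))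
    {Te : Tube} (hTe : Te ∈ Lc) (hJ : SpokeMeetsRot i (extSpokeTube M F.k T₀ w L ε) Te)
    {t : ℤ} (ht : -(2 * (M : ℤ)) + (4 * M / 16 : ℕ) ≤ t ∧ t ≤ -(M : ℤ) - (4 * M / 16 : ℕ))
    {r e s j₀ d : ℕ} (he : 2 * e ≤ r) (hSL : ∀ T ∈ vchunks r (-(r : ℤ)) e s j₀ (d + 1), T ∈ Lc)
    (hlo : -(r : ℤ) + j₀ * s - e ≤ t) (hhi : t + (4 * M / 64 : ℕ) ≤ -(r : ℤ) + (j₀ + d) * s - e)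
    {W : ℕ} (hW : (r : ℤ) - 2 * e + W = 4 * M + (4 * M / 16 : ℕ))
    (hH : ω ∈ triHCross ((r : ℤ) - 2 * e) t W (4 * M / 64)) (hV : ω ∈ otgtV (4 * M) t)
    (hM : 64 ≤ M) (hkL : (F.k : ℤ) + L ≤ 2 * M) (hnr : (n : ℤ) ≤ (r : ℤ) - 2 * e) (hrN : (r : ℤ) + e ≤ 4 * M) :
    ω ∈ extOpenArm n (4 * M) :=
  rot_exit_landing_move_chain' hnM hi F.toTrapExit hmid hR hkM hwin hT₀ hfit hL hSp hch harc hLreg hTe hJ ht he hSL hlo hhi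
    hW hH hV hM hkL hnr hrN

end Literature.Probability.Percolation
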